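import Summits.Ventures.HSemireg.WedgeSurfacePowersPerQ

/-!
# Venture HSemireg — the PER-`q` ranks of the `n`-fold SURFACE BOX, 2/3: the image `E_s ∧ F_n` of a source monomial is a unit
# times the ORDERED PRODUCT of its local images; block projections; supports of class vectors; WHICH BLOCKS A CLASS REACHES

HONEST FRAMING. Part of the Lean index of the computation cell `pub-hsemireg` (seat p10 gen 3, Sunday typer «UNIFORM-IN-n»).
Finite-dimensional EXTERIOR ALGEBRA over a field ONLY: no variety, no cohomology theory, no sheaf, no Ext group, no semiregularity
map is constructed here; nothing here says that HC / HC_CM / HC_AV holds; no Literature fact is declared or used.  Custodian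
versions: STRUCTURE.md v1.0-SIGNED 9b196a05977dd067, theory/FORMULA-N.md PART A §4.1″ (th-6) / PART B (th-7).  Model and dictionary:
see file 1/3 (`WedgeSurfacePowersPerQ.lean`).

THIS FILE (the class decomposition of HOME/p10/SURFACE-POWER-PERQ-p10.md §2, steps 1–3): §0 the `q`-BLOCK PROJECTION `blockProj q`
of `⋀ K^{4n}` onto `span{E_T : qdeg T = q}` and its coordinates; §1 the ORDERED PRODUCT `lprod s j = ℓ₀(s) ∧ ⋯ ∧ ℓ_{j−1}(s)` of the
local images `ℓ_i(s) = E_{s ∩ D_i} ∧ f_i` and **`E_s ∧ F_n = unit • lprod s n`** (`B_mul_surfaceBox`; th-7's `B_mul_mul` iterated —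
the unit is a product of structure constants and parity signs and is never evaluated); §2 COORDINATES of the ordered product
factor block by block (th-7's `coord_mul` iterated): `E_T` occurs in `E_s ∧ F_n` iff on every block the letters of `T` are a local
target of the letters of `s` (`coord_lprod_n_ne_zero_iff`); a dead block kills the image; proportional local images give
proportional products; §3 the CLASS VECTOR `vec f = lprod (src f) n` of option data `f : Fin n → Fin 6`: its support
(`coord_vec_ne_zero_iff`), **distinct classes have disjoint supports** (`coord_vec_eq_zero_or`), and **the `q`-block component of
the class of `f` is non-zero iff `q = q_f(f) + 2j` for some `j ≤ z(f)`** (`blockProj_vec_ne_zero_iff`; `z(f)` = number of empty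
blocks, each showing `E_{X_i}` (`+0`) or `E_{Y_i}` (`+2`) in the SAME source vector — th-6's coincidence; `q_f(f)` = number of
single-`X`-letter blocks).  File 3/3 turns this into the rank theorem.
Namespace `Summit.Ventures.HSemireg.Wedge.SurfacePowers`, new names only; nothing of th-7 / th-6 / p3 restated.
-/

open Module Set Set.powersetCard

namespace Summit.Ventures.HSemireg.Wedge.SurfacePowers

open Summit.Ventures.HSemireg.Wedge Summit.Ventures.HSemireg.Wedge.Kunneth

variable (K : Type*) [Field K]

/-- the empty monomial is `1`. -/
lemma B_empty (I : Type*) [LinearOrder I] [Fintype I] : B K I ∅ = 1 := by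
  rw [B, ExteriorAlgebra.basis_apply_ofCard (b K I) Finset.card_empty]
  simp [ExteriorAlgebra.ιMulti_family]

/-- `Alg` is monotone in the block. -/
lemma Alg_mono {I : Type*} [LinearOrder I] [Fintype I] {D D' : Finset I} (h : D ⊆ D') : Alg K I D ≤ Alg K I D' :=
  Submodule.span_mono (by rintro _ ⟨s, hs, rfl⟩; exact ⟨s, subset_trans hs h, rfl⟩)

/-- an element is non-zero iff some monomial coordinate is. -/
lemma ne_zero_iff_exists_coord {I : Type*} [LinearOrder I] [Fintype I] (v : HT K I) :
    v ≠ 0 ↔ ∃ T, (B K I).coord T v ≠ 0 := by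
  rw [Ne, (B K I).ext_elem_iff, not_forall]
  simp only [map_zero, Finsupp.coe_zero, Pi.zero_apply, Basis.coord_apply]

variable {n : ℕ}

/-! ## §0. The `q`-block projections of `⋀ K^{4n}` -/

variable (n) in
/-- the projection of `⋀ K^{4n}` onto the `q`-block `span{E_T : qdeg T = q}` along the complementary monomials. -/
noncomputable def blockProj (q : ℕ) : HT K (Fin (4 * n)) →ₗ[K] HT K (Fin (4 * n)) :=
  (B K (Fin (4 * n))).constr K fun T => if qdeg n T = q then B K (Fin (4 * n)) T else 0

/-- the block projection on a monomial. -/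
lemma blockProj_B (q : ℕ) (T : Finset (Fin (4 * n))) :
    blockProj K n q (B K (Fin (4 * n)) T) = if qdeg n T = q then B K (Fin (4 * n)) T else 0 := by
  rw [blockProj, Basis.constr_basis]

/-- **coordinates of the block projection**: `coord_T (blockProj q v) = [qdeg T = q] · coord_T v`. -/
theorem coord_blockProj (q : ℕ) (T : Finset (Fin (4 * n))) (v : HT K (Fin (4 * n))) :
    (B K (Fin (4 * n))).coord T (blockProj K n q v) = if qdeg n T = q then (B K (Fin (4 * n))).coord T v else 0 := by
  have key : (B K (Fin (4 * n))).coord T ∘ₗ blockProj K n q =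
      (if qdeg n T = q then (1 : K) else 0) • (B K (Fin (4 * n))).coord T := by
    apply (B K (Fin (4 * n))).ext
    intro T'
    rw [LinearMap.comp_apply, blockProj_B, LinearMap.smul_apply, coord_B, smul_eq_mul]
    by_cases hT : T' = T
    · subst hT
      by_cases hq : qdeg n T' = q
      · rw [if_pos hq, if_pos hq, coord_B, if_pos rfl, one_mul]
      · rw [if_neg hq, if_neg hq, map_zero, zero_mul]
    · by_cases hq : qdeg n T' = q
      · rw [if_pos hq, coord_B, if_neg hT, mul_zero]
      · rw [if_neg hq, map_zero, if_neg hT, mul_zero]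
  rw [← LinearMap.comp_apply, key, LinearMap.smul_apply, smul_eq_mul]
  split_ifs <;> simp

/-! ## §1. The ordered product of the local images -/

/-- the ORDERED PRODUCT `ℓ₀(s) ∧ ⋯ ∧ ℓ_{j−1}(s)` of the local images `ℓ_i(s) = E_{s ∩ D_i} ∧ f_i` of a source `E_s`. -/
noncomputable def lprod (a c : K) (s : Finset (Fin (4 * n))) : ℕ → HT K (Fin (4 * n))
  | 0 => 1
  | j + 1 => lprod a c s j * (if h : j < n then limg K a c s ⟨j, h⟩ else 1)

/-- one more block. -/
lemma lprod_succ (a c : K) (s : Finset (Fin (4 * n))) {j : ℕ} (hj : j < n) :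
    lprod K a c s (j + 1) = lprod K a c s j * limg K a c s ⟨j, hj⟩ := by
  show _ * dite _ _ _ = _
  rw [dif_pos hj]

/-- past the last block nothing changes. -/
lemma lprod_succ_of_le (a c : K) (s : Finset (Fin (4 * n))) {j : ℕ} (hj : n ≤ j) :
    lprod K a c s (j + 1) = lprod K a c s j := by
  show _ * dite _ _ _ = _
  rw [dif_neg (by omega), mul_one]

/-- `U 0 = ∅`. -/
lemma U_zero : U n 0 = ∅ := by
  ext x; simp [mem_U]

/-- `U j ⊆ U (j+1)`. -/
lemma U_subset_succ (j : ℕ) : U n j ⊆ U n (j + 1) := by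
  intro x hx; rw [mem_U] at hx ⊢; omega

/-- `D j ⊆ U (j+1)`. -/
lemma D_subset_U_succ {j : ℕ} (hj : j < n) : D n ⟨j, hj⟩ ⊆ U n (j + 1) := by
  rw [U_succ n hj]; exact Finset.subset_union_right

/-- the product of the first `j` surface factors is homogeneous of degree `2j` on `U j` (including `j = 0`). -/
lemma prodFac_mem_Hom {a c : K} (ha : a ≠ 0) (hc : c ≠ 0) :
    ∀ j, j ≤ n → prodFac K (n := n) a c j ∈ Hom K (Fin (4 * n)) (U n j) (2 * j)
  | 0, _ => by
    rw [U_zero]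
    show (1 : HT K (Fin (4 * n))) ∈ _
    rw [← B_empty]
    exact B_mem_Hom K (Finset.empty_subset _) rfl
  | j + 1, h => ((prodFac_spec K ha hc) (j + 1) (by omega) h).1

/-- the ordered product lies in the algebra of the first `j` blocks. -/
lemma lprod_mem_Alg (a c : K) (s : Finset (Fin (4 * n))) : ∀ j, lprod K a c s j ∈ Alg K (Fin (4 * n)) (U n j)
  | 0 => by
    show (1 : HT K (Fin (4 * n))) ∈ _
    rw [← B_empty]
    exact B_mem_Alg K (Finset.empty_subset _)
  | j + 1 => by
    by_cases hj : j < n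
    · rw [lprod_succ K a c s hj]
      exact mul_mem_Alg K (Alg_mono K (U_subset_succ j) (lprod_mem_Alg a c s j))
        (Alg_mono K (D_subset_U_succ hj) (limg_mem_Alg K a c s ⟨j, hj⟩))
    · rw [lprod_succ_of_le K a c s (by omega)]
      exact Alg_mono K (U_subset_succ j) (lprod_mem_Alg a c s j)

/-- **`E_s ∧ (f₀ ∧ ⋯ ∧ f_{j−1}) = unit • ℓ₀(s) ∧ ⋯ ∧ ℓ_{j−1}(s)`** on the part of `s` in the first `j` blocks (th-7's `B_mul_mul`,
iterated; the unit is a product of structure constants and parity signs, never evaluated). -/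
theorem B_mul_prodFac {a c : K} (ha : a ≠ 0) (hc : c ≠ 0) (s : Finset (Fin (4 * n))) :
    ∀ j, j ≤ n → ∃ μ : K, μ ≠ 0 ∧
      B K (Fin (4 * n)) (s ∩ U n j) * prodFac K (n := n) a c j = μ • lprod K a c s j := by
  intro j hj
  induction j with
  | zero =>
    refine ⟨1, one_ne_zero, ?_⟩
    rw [U_zero, Finset.inter_empty, B_empty, one_smul, one_mul]
    rfl
  | succ j ih =>
    obtain ⟨μ, hμ, e⟩ := ih (by omega)
    have hjn : j < n := by omega
    have eP : prodFac K (n := n) a c (j + 1) = prodFac K (n := n) a c j * fac K a c ⟨j, hjn⟩ := by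
      show _ * dite _ _ _ = _
      rw [dif_pos hjn]
    have hsub : s ∩ U n (j + 1) ⊆ U n j ∪ D n ⟨j, hjn⟩ := by
      rw [← U_succ n hjn]; exact Finset.inter_subset_right
    have h1 : s ∩ U n (j + 1) ∩ U n j = s ∩ U n j := by
      rw [Finset.inter_assoc, Finset.inter_eq_right.mpr (U_subset_succ j)]
    have h2 : s ∩ U n (j + 1) ∩ D n ⟨j, hjn⟩ = s ∩ D n ⟨j, hjn⟩ := by
      rw [Finset.inter_assoc, Finset.inter_eq_right.mpr (D_subset_U_succ hjn)]
    have hdisj : Disjoint (s ∩ U n j) (s ∩ D n ⟨j, hjn⟩) :=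
      disjoint_of_subsets (disjoint_U_D n hjn) Finset.inter_subset_right Finset.inter_subset_right
    refine ⟨(u K (s ∩ U n j) (s ∩ D n ⟨j, hjn⟩))⁻¹ * (-1 : K) ^ ((s ∩ D n ⟨j, hjn⟩).card * (2 * j)) * μ,
      mul_ne_zero (mul_ne_zero (inv_ne_zero ((u_ne_zero_iff K).mpr hdisj))
        (pow_ne_zero _ (neg_ne_zero.mpr one_ne_zero))) hμ, ?_⟩
    rw [eP, B_mul_mul K (disjoint_U_D n hjn) (prodFac_mem_Hom K ha hc j (by omega)) _ hsub, h1, h2, e,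
      lprod_succ K a c s hjn, smul_mul_assoc, smul_smul]
    rfl

/-- **`E_s ∧ F_n = unit • ℓ₀(s) ∧ ⋯ ∧ ℓ_{n−1}(s)`**. -/
theorem B_mul_surfaceBox {a c : K} (ha : a ≠ 0) (hc : c ≠ 0) (s : Finset (Fin (4 * n))) :
    ∃ μ : K, μ ≠ 0 ∧ B K (Fin (4 * n)) s * surfaceBox K (n := n) a c = μ • lprod K a c s n := by
  have h := B_mul_prodFac K ha hc s n le_rfl
  rwa [U_self, Finset.inter_univ] at h

/-! ## §2. Coordinates of the ordered product: a target monomial occurs iff it occurs block by block -/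

/-- `T ∩ U (j+1) = (T ∩ U j) ⊔ (T ∩ D j)`. -/
lemma inter_U_succ (T : Finset (Fin (4 * n))) {j : ℕ} (hj : j < n) :
    T ∩ U n (j + 1) = T ∩ U n j ∪ T ∩ D n ⟨j, hj⟩ := by
  rw [U_succ n hj, Finset.inter_union_distrib_left]

/-- block-by-block factorisation of the coordinates of the ordered product (th-7's `coord_mul`, iterated): the
`T ∩ U_j`-coordinate of `ℓ₀ ∧ ⋯ ∧ ℓ_{j−1}` is non-zero iff every `T ∩ D_i`-coordinate of `ℓ_i` is, `i < j`. -/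
theorem coord_lprod_ne_zero_iff (a c : K) (s T : Finset (Fin (4 * n))) :
    ∀ j, j ≤ n → ((B K (Fin (4 * n))).coord (T ∩ U n j) (lprod K a c s j) ≠ 0 ↔
      ∀ i : Fin n, (i : ℕ) < j → (B K (Fin (4 * n))).coord (T ∩ D n i) (limg K a c s i) ≠ 0) := by
  intro j hj
  induction j with
  | zero =>
    rw [U_zero, Finset.inter_empty, show lprod K a c s 0 = 1 from rfl, ← B_empty, coord_B, if_pos rfl]
    simp
  | succ j ih =>
    have hjn : j < n := by omega
    rw [inter_U_succ T hjn, lprod_succ K a c s hjn,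
      coord_mul K (disjoint_U_D n hjn) (lprod_mem_Alg K a c s j) (limg_mem_Alg K a c s ⟨j, hjn⟩)
        Finset.inter_subset_right Finset.inter_subset_right,
      mul_ne_zero_iff, mul_ne_zero_iff, ih (by omega)]
    have hu : u K (T ∩ U n j) (T ∩ D n ⟨j, hjn⟩) ≠ 0 :=
      (u_ne_zero_iff K).mpr (disjoint_of_subsets (disjoint_U_D n hjn) Finset.inter_subset_right Finset.inter_subset_right)
    constructor
    · rintro ⟨⟨-, h1⟩, h2⟩ i hi
      rcases Nat.lt_succ_iff_lt_or_eq.mp hi with hi | hi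
      · exact h1 i hi
      · have : i = ⟨j, hjn⟩ := Fin.ext hi
        subst this
        exact h2
    · intro h
      exact ⟨⟨hu, fun i hi => h i (Nat.lt_succ_of_lt hi)⟩, h ⟨j, hjn⟩ (Nat.lt_succ_self j)⟩

/-- **support of the image of a source**: `E_T` occurs in `ℓ₀(s) ∧ ⋯ ∧ ℓ_{n−1}(s)` iff on every block `i` the letters of `T` form a
local target of the letters of `s` (`a, c ≠ 0`). -/
theorem coord_lprod_n_ne_zero_iff {a c : K} (ha : a ≠ 0) (hc : c ≠ 0) (s T : Finset (Fin (4 * n))) :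
    (B K (Fin (4 * n))).coord T (lprod K a c s n) ≠ 0 ↔ ∀ i : Fin n, pb n i T ∈ ltg (pb n i s) := by
  have h := coord_lprod_ne_zero_iff K a c s T n le_rfl
  rw [U_self, Finset.inter_univ] at h
  rw [h]
  exact forall_congr' fun i => by rw [coord_limg_ne_zero_iff K ha hc]; exact ⟨fun h' => h' i.2, fun h' _ => h'⟩

/-- a dead block kills the whole image. -/
lemma lprod_eq_zero_of_limg (a c : K) (s : Finset (Fin (4 * n))) (i : Fin n) (h : limg K a c s i = 0) :
    lprod K a c s n = 0 := by
  have key : ∀ m, lprod K a c s ((i : ℕ) + 1 + m) = 0 := by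
    intro m
    induction m with
    | zero => rw [add_zero, lprod_succ K a c s i.2, h, mul_zero]
    | succ m ih =>
      rw [← add_assoc]
      show lprod K a c s _ * dite _ _ _ = 0
      rw [ih, zero_mul]
  have e : n = (i : ℕ) + 1 + (n - i - 1) := by have := i.2; omega
  have h2 := key (n - i - 1)
  rw [← e] at h2
  exact h2

/-- proportional local images give proportional products. -/
lemma lprod_smul_of_limg (a c : K) (s s' : Finset (Fin (4 * n))) (μ : Fin n → K)
    (h : ∀ i, limg K a c s i = μ i • limg K a c s' i) : ∀ j, ∃ Λ : K, lprod K a c s j = Λ • lprod K a c s' j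
  | 0 => ⟨1, by rw [one_smul]; rfl⟩
  | j + 1 => by
    obtain ⟨Λ, e⟩ := lprod_smul_of_limg a c s s' μ h j
    by_cases hj : j < n
    · refine ⟨Λ * μ ⟨j, hj⟩, ?_⟩
      rw [lprod_succ K a c s hj, lprod_succ K a c s' hj, e, h, smul_mul_smul_comm]
    · refine ⟨Λ, ?_⟩
      rw [lprod_succ_of_le K a c s (by omega), lprod_succ_of_le K a c s' (by omega), e]

/-! ## §3. Class vectors of option data: support, disjointness, reachable blocks -/

/-- the CLASS VECTOR of option data `f`: the ordered product of the local images of the canonical source `src f`. -/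
noncomputable def vec (a c : K) (f : Fin n → Fin 6) : HT K (Fin (4 * n)) := lprod K a c (src f) n

/-- support of a class vector: block by block, the letters of `T` form a local target of the chosen canonical source. -/
theorem coord_vec_ne_zero_iff {a c : K} (ha : a ≠ 0) (hc : c ≠ 0) (f : Fin n → Fin 6) (T : Finset (Fin (4 * n))) :
    (B K (Fin (4 * n))).coord T (vec K a c f) ≠ 0 ↔ ∀ i : Fin n, pb n i T ∈ ltg (opt (f i)) := by
  rw [vec, coord_lprod_n_ne_zero_iff K ha hc]
  simp only [pb_src]

/-- **DISTINCT CLASSES HAVE DISJOINT SUPPORTS** (a target monomial determines the class, block by block). -/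
theorem coord_vec_eq_zero_or {a c : K} (ha : a ≠ 0) (hc : c ≠ 0) {f f' : Fin n → Fin 6} (hff : f ≠ f')
    (T : Finset (Fin (4 * n))) :
    (B K (Fin (4 * n))).coord T (vec K a c f) = 0 ∨ (B K (Fin (4 * n))).coord T (vec K a c f') = 0 := by
  by_contra h
  rw [not_or, ← Ne, ← Ne, coord_vec_ne_zero_iff K ha hc, coord_vec_ne_zero_iff K ha hc] at h
  exact hff (funext fun i => opt_eq_of_mem_ltg (f i) (f' i) _ (h.1 i) (h.2 i))

/-- the number of EMPTY blocks of option data. -/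
def zf (f : Fin n → Fin 6) : ℕ := ∑ i, lz (f i)

/-- the FIXED `q`-part of option data (number of single-`X`-letter blocks). -/
def qff (f : Fin n → Fin 6) : ℕ := ∑ i, lqf (f i)

/-- `zf` counts the empty blocks. -/
lemma zf_eq_card (f : Fin n → Fin 6) : zf f = (Finset.univ.filter fun i => f i = 0).card := by
  rw [zf, Finset.card_filter]
  exact Finset.sum_congr rfl fun i _ => by rw [(lz_eq (f i)).1]; exact if_congr (lz_eq (f i)).2 rfl rfl

/-- the `q` of a monomial in the support of a class vector is the fixed part plus twice the number of empty blocks showing `Y`. -/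
lemma qdeg_eq_of_support {f : Fin n → Fin 6} {T : Finset (Fin (4 * n))} (h : ∀ i : Fin n, pb n i T ∈ ltg (opt (f i))) :
    qdeg n T = qff f + 2 * (Finset.univ.filter fun i => f i = 0 ∧ pb n i T = Y4).card := by
  rw [qdeg_eq_sum, qff, Finset.card_filter, Finset.mul_sum, ← Finset.sum_add_distrib]
  exact Finset.sum_congr rfl fun i _ => by rw [lq_of_mem_ltg (f i) _ (h i), mul_ite, mul_zero, mul_one]

/-- a monomial of prescribed block contents: glue local letter sets `g i` along the blocks. -/
def glue (g : Fin n → Finset (Fin (2 + 2))) : Finset (Fin (4 * n)) := Finset.univ.biUnion fun i => lift n i (g i)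

/-- block `i` of the glued monomial is `g i`. -/
lemma pb_glue (g : Fin n → Finset (Fin (2 + 2))) (i : Fin n) : pb n i (glue g) = g i := by
  ext j
  rw [mem_pb, glue, Finset.mem_biUnion]
  constructor
  · rintro ⟨i', -, h⟩
    obtain rfl : i = i' := blockEmb_mem_D_iff.mp (lift_subset_D i' _ h)
    obtain ⟨j', hj', e⟩ := mem_lift.mp h
    rwa [← (blockEmb n i).injective e]
  · intro hj
    exact ⟨i, Finset.mem_univ _, mem_lift.mpr ⟨j, hj, rfl⟩⟩

/-- **WHICH BLOCKS A CLASS REACHES**: some monomial of Dolbeault index `q` occurs in the class vector of `f` iff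
`q = q_f + 2j` for some `j ≤ z` (`z` empty blocks, each showing `X` (`+0`) or `Y` (`+2`); fixed part `q_f`). -/
theorem exists_coord_blockProj_vec_ne_zero_iff {a c : K} (ha : a ≠ 0) (hc : c ≠ 0) (f : Fin n → Fin 6) (q : ℕ) :
    (∃ T, (B K (Fin (4 * n))).coord T (blockProj K n q (vec K a c f)) ≠ 0) ↔ ∃ j, j ≤ zf f ∧ q = qff f + 2 * j := by
  simp only [coord_blockProj, ne_eq, ite_eq_right_iff, Classical.not_imp]
  constructor
  · rintro ⟨T, hq, hT⟩
    rw [← ne_eq, coord_vec_ne_zero_iff K ha hc] at hT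
    refine ⟨(Finset.univ.filter fun i => f i = 0 ∧ pb n i T = Y4).card, ?_, by rw [← hq, qdeg_eq_of_support hT]⟩
    rw [zf_eq_card]
    exact Finset.card_le_card (Finset.monotone_filter_right _ fun i _ h => h.1)
  · rintro ⟨j, hj, rfl⟩
    rw [zf_eq_card] at hj
    obtain ⟨J, hJ, hJc⟩ := Finset.exists_subset_card_eq hj
    have hJ0 : ∀ i ∈ J, f i = 0 := fun i hi => (Finset.mem_filter.mp (hJ hi)).2
    let g : Fin n → Finset (Fin (2 + 2)) := fun i => if i ∈ J then Y4 else ltgt (f i)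
    have hsupp : ∀ i : Fin n, pb n i (glue g) ∈ ltg (opt (f i)) := by
      intro i
      rw [pb_glue]
      by_cases hi : i ∈ J
      · simp only [g, if_pos hi, hJ0 i hi]; exact Y4_mem_ltg_empty.1
      · simp only [g, if_neg hi]; exact (ltgt_mem_ltg (f i)).1
    refine ⟨glue g, ?_, by rw [← ne_eq, coord_vec_ne_zero_iff K ha hc]; exact hsupp⟩
    have hq : ∀ i, lq (pb n i (glue g)) = lqf (f i) + (if i ∈ J then 2 else 0) := by
      intro i
      rw [pb_glue]
      by_cases hi : i ∈ J
      · simp only [g, if_pos hi, hJ0 i hi]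
        rw [Y4_mem_ltg_empty.2.1, Y4_mem_ltg_empty.2.2.2]
      · simp only [g, if_neg hi, add_zero]
        exact (ltgt_mem_ltg (f i)).2
    rw [qdeg_eq_sum, Finset.sum_congr rfl (fun i _ => hq i), Finset.sum_add_distrib, qff, ← hJc, Finset.sum_ite_mem,
      Finset.univ_inter, Finset.sum_const, smul_eq_mul, mul_comm]

/-- so **the `q`-block component of the class vector of `f` is non-zero iff `q = q_f + 2j`, `j ≤ z`**. -/
theorem blockProj_vec_ne_zero_iff {a c : K} (ha : a ≠ 0) (hc : c ≠ 0) (f : Fin n → Fin 6) (q : ℕ) :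
    blockProj K n q (vec K a c f) ≠ 0 ↔ ∃ j, j ≤ zf f ∧ q = qff f + 2 * j := by
  rw [ne_zero_iff_exists_coord, exists_coord_blockProj_vec_ne_zero_iff K ha hc]

end Summit.Ventures.HSemireg.Wedge.SurfacePowers
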